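import Summits.BirchSwinnertonDyer.BirchSwinnertonDyer.Theses.ThetaPartnerAtTwo
import Summits.BirchSwinnertonDyer.BirchSwinnertonDyer.Theses.ResidualThetaTransportAtTwo
import Summits.BirchSwinnertonDyer.BirchSwinnertonDyer.Theorems.ThetaPartnerAtTwoSignedControlAtTwoCasselsOfPT
import Summits.BirchSwinnertonDyer.BirchSwinnertonDyer.Theorems.ThetaPartnerAtTwoSignedControlAtTwoCoinvOfResTwo
import Summits.BirchSwinnertonDyer.BirchSwinnertonDyer.Theorems.ThetaPartnerAtTwoSignedControlAtTwoResTwoOfShaTwo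
import Summits.BirchSwinnertonDyer.BirchSwinnertonDyer.Theorems.ThetaPartnerAtTwoSignedControlAtTwoShaTwoPrimaryVanishing
import Summits.BirchSwinnertonDyer.BirchSwinnertonDyer.Theorems.ThetaPartnerAtTwoSignedControlAtTwoShaThreeSylowField
import Literature.NumberTheory.GaloisCohomology.PoitouTateTwoRealPlacesSurjectiveHolds
import Summits.BirchSwinnertonDyer.BirchSwinnertonDyer.Theorems.SchneiderFreeAdditiveX3PoitouTateSelmerDualityHolds
import Summits.BirchSwinnertonDyer.BirchSwinnertonDyer.Theorems.ThetaPartnerAtTwoSignedControlAtTwoShaThreeBaseH3Units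
import Summits.BirchSwinnertonDyer.BirchSwinnertonDyer.Theorems.ThetaPartnerAtTwoSignedControlAtTwoShaTwoOfBridgeOfLocalGlobal
import Summits.BirchSwinnertonDyer.BirchSwinnertonDyer.Theorems.SchneiderFreeAdditiveX3PoitouTateReciprocityEqualityHolds
import Summits.BirchSwinnertonDyer.BirchSwinnertonDyer.Theorems.SchneiderFreeAdditiveX3PoitouTateShaTwoLocalGlobalReal
import HarnessLib

/-!
# K4 `SignedControlAtTwo` (stmt-BirchSwinnertonDyer-20309) — skeleton line `eulerchar`, v17 FINAL (all stubs discharged; landed as Theorems/ThetaPartnerAtTwoSignedControlAtTwo.lean p630337) (lead bsd-wall-tp2-p3 g6, 2026-08-28T11:2xZ; v15 = 10:5xZ, v14 = g5 10:1xZ)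

Route `route-BirchSwinnertonDyer-ThetaPartnerAtTwo` (TP2; crux shared with `ResidualThetaTransportAtTwo`), crux K4, rank 5.
History: v1 (planner g5, 1799033ea9ab6fb2) · v4 (lead g0) {INJ⁺@2, Cassels, KIM⁺@2} · v5/v6 (lead g2) {HONDA⁺@2} + PUB×5 · v7 ONE stub PUB×4 ·
v8/v9 (lead g3) PUB×2 + (I1) · v10 (width seat w2 g4, 0b2d5586284b035f): ONE stub `stub_pubGreenbergPTTwo` = Cassels ∧ Prop 4.12 ∧
`poitouTate_selmerStructure_duality ℚ` · v12 (lead g4, d717d3b34c614243): FOUR generic PT facts over ℚ (4.10(a)(b)(c)₃, Cor 4.16).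

**v16 (this file): = v15 with stub 3 `stub_realThreeOrderTwoBase` (the μ₂ base case of Milne I 4.10(c)₃ over EVERY number field)
DISCHARGED by width seat w3 g9's theorem `SignedEC.ShaThreeBrauer.stub_realThreeOrderTwoBase` (p628282 ✓: Tate's `H³(Γ_F, F̄ˣ) = 0`
from the idèle class formation + (hBr) + the lead g5's B7) — ONE stub remains: `stub_poitouTateShaRat` (Milne I 4.10(a) over `ℚ`),
closer = k4-p1's `SignedEC.PoitouTateShaRat.poitouTate_sha_tateDual_rat_of_bridge_of_localGlobal (hcomp ✓ p626891) (hR4: door-c5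
p627677 modulo F2 `hRur`) (hA: chl-p2 (A3) ✓ p627417 + sequel)`.  `poitouTate_three_realPlaces_injective ℚ` is now unconditional.**

**v15: = v14 with stub 1 `stub_poitouTateSelmerRat` (Milne I 4.10(b) for Selmer structures over `ℚ`) DISCHARGED by
cell bsd-schneider door-c4 g18's theorem `SchneiderFreeAdditiveX3.PoitouTateReduction.poitouTate_selmerStructure_duality_holds ℚ`
(p624636 ✓ 10:27Z, every number field) — TWO stubs remain: `stub_poitouTateShaRat` (4.10(a) ℚ: `Ш²(ℚ,M) ≅ Ш¹(ℚ,M^D)^∨`, finite `M`)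
and `stub_realThreeOrderTwoBase` (the μ₂ base case of 4.10(c)₃ over every number field; w2 g7 road NORM_T / w3 g9 road (hBr)).
Cassels (`hC` below) is now UNCONDITIONAL.**

**v14: = v13 with `stub_poitouTateTwoRealAll` DISCHARGED by width seat w2 g6's theorem
`Literature.NumberTheory.GaloisCohomology.poitouTate_two_realPlaces_surjective_holds` (p618871, Milne I Cor. 4.16 for EVERY number field,
explicit carry cocycle) — THREE stubs remain: `stub_poitouTateSelmerRat` (4.10(b) ℚ), `stub_poitouTateShaRat` (4.10(a) ℚ),
`stub_realThreeOrderTwoBase` (the μ₂ base case of 4.10(c)₃, every number field; ⟸ {(hH3), (hBr)} by B7 p623710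
`ShaThree.realThree_injective_orderTwo_of_brauer`, or w2 g7's Gysin road).**

**v13 (lead g5): stub 3 of v12 (`poitouTate_three_realPlaces_injective ℚ`, Milne I 4.10(c)₃ for ALL finite `M`) is now
DERIVED (`poitouTateThreeRealRat`) by the lead's landed dévissage (`…ShaThreeExtension/PGroup/OddDescent/Assembly/SylowField`,
p620141 p620633 p621205 p621896 p622411: extension step, 2-group filtration, odd-degree descent with `map_eq_map_of_inner_three` and
Artin–Schreier, `cd_p ≤ 2` odd part, 2-Sylow splitting field) from TWO smaller stubs: `stub_realThreeOrderTwoBase` = the BASE CASE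
`H³(F, ℤ/2) ↪ ⊕_{w real} H³(F_w, ℤ/2)` for every number field `F` and every TRIVIAL module of order 2 (CFT for `μ₂` only:
`Br(F)/2 ≅ ⊕_real ℤ/2` by Brauer–Hasse–Noether + `H³(F, 𝔾_m)[2] = 0`; memo `STUB3-DEVISSAGE.md`), and `stub_poitouTateTwoRealAll` =
Milne I Cor 4.16 for EVERY number field (w2 g6's lane; the v12 stub 4 over ℚ is its instance `poitouTateTwoRealRat`). Stubs 1, 2 unchanged.**

**v11/v12 (this file): Greenberg's Prop. 4.13 (Cassels) AND Prop. 4.12 BOTH leave the registered residue; in v12 the residue is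
FOUR GENERIC named facts of global duality (Milne ADT I Thm. 4.10 (a)(b)(c), Cor. 4.16) — nothing about elliptic curves.**
* Cassels ⟸ PT(b): width seat w3 g5's `SignedEC.CasselsPT.casselsSurjectivity_H1Sigma_of_poitouTate`
  (`…CasselsOfPT`, with `…CasselsLocalTerms/Bockstein/ArchH2/PTModKummer/Lift`): Greenberg LNM 1716 Prop. 4.13 / p. 122 from
  Poitou–Tate for Selmer structures over `ℚ` — the real place and `p = 2` included.
* Prop. 4.12 ⟸/ REPLACED by a LEVEL-ℚ statement: width seat w2 g5's habitat road (`…HOneCoinvObstruction` p608418, `…CoinvOfResTwo`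
  p609591, `…ResTwoOfShaTwo` p610245; inputs-k4-p1's `PadicQuotientHOneCoinvariants`/`HochschildSerreEdgeCoinvariants` in parallel): K4 used
  Prop. 4.12 only as DIV «(γ−1)H = H»; the COINV door accepts the FULL ambient `H¹(ℚ_∞, E[2^∞])`, which is (γ−1)-divisible as soon as
  `res : H²(Γ_ℚ, E[2^∞]) → H²(Gal(ℚ̄/ℚ_∞), E[2^∞])` is injective (obstruction class / Hochschild–Serre edge), and THAT follows from
  `Ш²(ℚ, E[2^∞]) = 0` (the real place lies below `ℚ_∞`; `H²(ℚ_v, E[2^∞]) = 0` at every finite `v` on the row). So the second stub is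
  now the VANISHING OF `Ш²(ℚ, E[2^∞])` on the row given `Sel_{2^∞}(E/ℚ)` finite — in print: Poitou–Tate (a) `Ш²(A) ≅ Ш¹(T)^∨` +
  `Ш¹(ℚ, T₂E) = 0` (Sel finite, `E(ℚ)[2] = 0`); in the tree: ⟸ `poitouTate_sha_tateDual ℚ` (existing named fact, counting at finite level)
  + the two real-place facts `poitouTate_two_realPlaces_surjective ℚ` / `poitouTate_three_realPlaces_injective ℚ` (Milne I Cor 4.16 /
  Thm 4.10(c), typed by w2 g5 p608975) — w2 g5 (D1/D2) and inputs-k4-p1 (L4) are proving exactly this stub.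
* Stubs of v11 (2): `stub_poitouTateSelmerRat` = `poitouTate_selmerStructure_duality ℚ` and `stub_shaTwoPrimaryVanishing` (above).
* **Stubs of v12 (4, all VERBATIM Literature named facts, `K = ℚ`)**: `stub_poitouTateSelmerRat : poitouTate_selmerStructure_duality ℚ` (Milne I
  4.10(b) for Selmer structures / Howard 2.1.11 — feeds Cassels), `stub_poitouTateShaRat : poitouTate_sha_tateDual ℚ` (Milne I 4.10(a), `Ш² ≅ (Ш¹)^∨`),
  `stub_poitouTateThreeRealRat : poitouTate_three_realPlaces_injective ℚ` (Milne I 4.10(c), `H³(ℚ,M) ↪ ⊕_real H³`), `stub_poitouTateTwoRealRat :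
  poitouTate_two_realPlaces_surjective ℚ` (Milne I Cor. 4.16, `H²(ℚ,M) ↠ ⊕_real H²`); the v11 stub `stub_shaTwoPrimaryVanishing` is now the THEOREM
  `SignedEC.ShaTwo.stub_shaTwoPrimaryVanishing_of_poitouTate` of width seat w2 g5 (p613197: finiteness of `Ш²(ℚ,E[2^∞])` from PT(a) counting
  + Sel finite, 2-divisibility from the real-place facts by the `H² → H² → H³` chase, `E(ℚ)[2] = 0` on the row). All four facts are outputs of the
  class-formation road (cell bsd-schneider); the lead's `…MuReal*` packet (p607121–p613215) is the p = 2 / real-place base layer of PT(b) on the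
  dévissage road.  Composition: conjunct (i) =
  `SignedSelmerDualData.moduleFinite`; conjunct (ii) = `kimControl_at_of_signedEulerCharTwo` ∘ w2 g5's
  `SignedEC.ResTwo.signedEulerChar_two_of_cassels_of_resTwo` with `hC` from Cassels ⟸ PT and `hres` from
  `SignedEC.ResTwo.resTwo_injective_of_shaTwo` ∘ `stub_shaTwoPrimaryVanishing` (the `Finite Sel` binder of conjunct (ii) is in scope where
  `hres` is consumed).  The binders `¬ W.HasCM`, `W.analyticRank = 0` of the crux are idle.
* Alternative closer (v10 road, still valid, in the tree): `SignedEC.CasselsPT.signedControlAtTwo_of_prop412_of_poitouTate h412 hPT`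
  (w3 g5 `…CasselsDoor`): K4 ⟸ {Prop 4.12, PT(ℚ)}.
No Greenberg-1999 print, no Kato, no corank count remains on the line. BSD is not proved by any of this.
-/

set_option autoImplicit false
set_option linter.dupNamespace false

noncomputable section

open Literature.NumberTheory.EllipticCurves Literature.NumberTheory.GaloisRepresentations
open Literature.NumberTheory.GaloisRepresentations.DiscreteGaloisModule (shaTwo)

namespace Summit.BirchSwinnertonDyer.BirchSwinnertonDyer.Cruxes.SignedControlAtTwo.EulerChar

/-- DERIVED (was the v14 stub 1; PUB, GENERIC): **Poitou–Tate duality for Selmer structures over `ℚ`** (Milne ADT I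
Thm. 4.10(b) with Cor. 2.3 / Thm. 2.6; Howard 2004 Thm. 2.1.11) — the tree's canonical named fact, now the THEOREM
`SchneiderFreeAdditiveX3.PoitouTateReduction.poitouTate_selmerStructure_duality_holds` of cell bsd-schneider door-c4 g18
(p624636 ✓, 2026-08-28T10:27Z: the E-side idèle package (P0)–(P4) of the presentation road, every number field, real places
included). Feeds Cassels (w3 `casselsSurjectivity_H1Sigma_of_poitouTate`).
[cite: MilneADT2006, Ch. I, Thm. 4.10(b)] [cite: Howard2004HeegnerKolyvagin, Thm. 2.1.11 (arXiv:1202.6340 p. 6)] -/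
theorem poitouTateSelmerRat :
    Literature.NumberTheory.GaloisCohomology.poitouTate_selmerStructure_duality ℚ :=
  Summit.BirchSwinnertonDyer.BirchSwinnertonDyer.Theorems.SchneiderFreeAdditiveX3.PoitouTateReduction.poitouTate_selmerStructure_duality_holds
    ℚ

/-- DERIVED (was the v16 stub 2, the LAST stub; PUB, GENERIC): **Poitou–Tate duality (a) `Ш²(ℚ, M) ≅ Ш¹(ℚ, M^D)^∨`** for
finite modules over `ℚ` (Milne ADT I Thm. 4.10(a); Tate 1962; Harari Thm. 17.13(b)) — the tree's named fact, assembled from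
the `Ш²`-readout road of cells bsd-schneider / bsd-wall: k4-p1's any-`K` closer
`SignedEC.PoitouTateShaRat.poitouTate_sha_tateDual_rat_of_bridge_of_localGlobal'` (p627308; hcomp := door-c4 g18
`selmerComplement_canonical_holds` inside) fed with the bridge (nat, R4=) `PoitouTateReduction.hR4_ideleProjection` (door-c5 g18
p629556: `hR4_ideleProjection_of_readoutUnramified` + F2 `hRur_holds` p629085 + `nat_bijective` + `exists_bidual_intertwining`) and
input (A) at a field WITH REAL PLACES `PoitouTateShaTwoReadout.tateDual_localGlobal_real` (door-c4 g19 p629062, porting chl-p2 g7's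
(A3) p627417 to the infinite places). [cite: MilneADT2006, Ch. I, Thm. 4.10(a)] [cite: Harari2020, Thm. 17.13 (b)] -/
theorem poitouTateShaRat :
    Literature.NumberTheory.GaloisCohomology.poitouTate_sha_tateDual ℚ :=
  Summit.BirchSwinnertonDyer.BirchSwinnertonDyer.Theorems.SignedEC.PoitouTateShaRat.poitouTate_sha_tateDual_rat_of_bridge_of_localGlobal'
    (fun n _ => Summit.BirchSwinnertonDyer.BirchSwinnertonDyer.Theorems.SchneiderFreeAdditiveX3.PoitouTateReduction.hR4_ideleProjection
      (K := ℚ) n)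
    (fun n _ _ _ _ _ _ ρ₀ hM =>
      Summit.BirchSwinnertonDyer.BirchSwinnertonDyer.Theorems.PoitouTateShaTwoReadout.tateDual_localGlobal_real ρ₀ n hM)

/-- DERIVED (was the v15 stub 3; the BASE CASE of Milne I 4.10(c)₃): **`H³(F, ℤ/2) → ⊕_{w real} H³(F_w, ℤ/2)` is injective
for every number field `F`** and every trivial `Γ_F`-module of order `2` — now the THEOREM
`SignedEC.ShaThreeBrauer.stub_realThreeOrderTwoBase` of width seat w3 g9 (p628282 ✓, 2026-08-28T11:2xZ): Tate's
`H³(Γ_F, F̄ˣ) = 0` (`galoisCohomology_units_three_eq_zero`, from the idèle class formation of cell bsd-schneider: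
`Ext³(ℤ, J̄) = 0`, `Ext²(ℤ, J̄) ↠ Ext²(ℤ, C̄)`, the Ext long exact sequence of `0 → F̄ˣ → J̄ → C̄ → 0`) + (hBr)
`realBrauer_two_divisible` (w3 g9 p627011) + the lead g5's B7 `ShaThree.realThree_injective_orderTwo_of_brauer`.
[cite: MilneADT2006, Ch. I, Thm. 4.10(c)] [cite: CasselsFrohlichANT1967, Ch. VII §11] -/
theorem realThreeOrderTwoBase :
    ∀ (F : Type) [Field F] [NumberField F] (T : Type) [AddCommGroup T] [TopologicalSpace T]
      [DiscreteTopology T] [Finite T] (σ : DiscreteGaloisModule F T),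
      (∀ (g : Field.absoluteGaloisGroup F) (t : T), σ g t = t) → Nat.card T = 2 →
        ∀ c : galoisCohomology σ 3,
          (∀ w : NumberField.InfinitePlace F, w.IsReal →
            galoisCohomology.localization σ (Sum.inl w) 3 c = 0) → c = 0 :=
  Summit.BirchSwinnertonDyer.BirchSwinnertonDyer.Theorems.SignedEC.ShaThreeBrauer.stub_realThreeOrderTwoBase

/-- DERIVED (was the v13 stub; PUB, GENERIC): **`H²(F, M) → ⊕_{v real} H²(F_v, M)` is surjective** for every number field `F` and
finite `M` (Milne ADT I Cor. 4.16) — width seat w2 g6's THEOREM `poitouTate_two_realPlaces_surjective_holds` (p618871, explicit carry cocycle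
of a Kummer sign character; no class field theory). [cite: MilneADT2006, Ch. I, Cor. 4.16] -/
theorem poitouTateTwoRealAll :
    ∀ (F : Type) [Field F] [NumberField F],
      Literature.NumberTheory.GaloisCohomology.poitouTate_two_realPlaces_surjective F :=
  Literature.NumberTheory.GaloisCohomology.poitouTate_two_realPlaces_surjective_holds

/-- DERIVED (was the v12 stub 3): **Milne I Thm. 4.10(c)₃ over `ℚ` for ALL finite `M`**, from the base case and Cor. 4.16 by the lead's
dévissage `ShaThree.poitouTate_three_realPlaces_injective_of_base` (p622411). [cite: MilneADT2006, Ch. I, Thm. 4.10(c)] -/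
theorem poitouTateThreeRealRat :
    Literature.NumberTheory.GaloisCohomology.poitouTate_three_realPlaces_injective ℚ :=
  Summit.BirchSwinnertonDyer.BirchSwinnertonDyer.Theorems.SignedEC.ShaThree.poitouTate_three_realPlaces_injective_of_base ℚ
    realThreeOrderTwoBase poitouTateTwoRealAll

/-- DERIVED (was the v12 stub 4): Milne I Cor. 4.16 over `ℚ`, the instance `F = ℚ` of `poitouTateTwoRealAll` (= w2 g6's
`…Theorems.SignedEC.PoitouTateReal.stub_poitouTateTwoRealRat`, p619586). [cite: MilneADT2006, Ch. I, Cor. 4.16] -/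
theorem poitouTateTwoRealRat :
    Literature.NumberTheory.GaloisCohomology.poitouTate_two_realPlaces_surjective ℚ :=
  poitouTateTwoRealAll ℚ

/-- DERIVED (no sorry of its own; was the v11 stub): **`Ш²(ℚ, E[2^∞]) = 0` on the row given `Sel_{2^∞}(E/ℚ)` finite**, from stub 2 and
the two derived real-place facts by w2 g5's `SignedEC.ShaTwo.stub_shaTwoPrimaryVanishing_of_poitouTate` (p613197).
[cite: MilneADT2006, Ch. I, Thm. 4.10(a),(c), Lemma 4.8, Cor. 4.16] [cite: GreenbergLNM1716, §4 p. 119] -/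
theorem shaTwoPrimaryVanishing :
    ∀ (W : WeierstrassCurve ℚ) [W.IsElliptic] [W.IsGloballyMinimal],
      Rank1Residual.GoodSS W 2 → W.frobeniusTrace 2 = 0 → Finite (W.selmerGroupPInfty 2) →
      ∀ c ∈ shaTwo (Summit.BirchSwinnertonDyer.Rank1Residual.X11b.LocBridge.primaryGaloisModule W 2), c = 0 :=
  Summit.BirchSwinnertonDyer.BirchSwinnertonDyer.Theorems.SignedEC.ShaTwo.stub_shaTwoPrimaryVanishing_of_poitouTate
    poitouTateShaRat poitouTateThreeRealRat poitouTateTwoRealRat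

/-- COMPOSITION (kernel-checked, no sorry of its own): both conjuncts of the crux body for EVERY curve of the row from the two stubs —
(i) `SignedSelmerDualData.moduleFinite`; (ii) `kimControl_at_of_signedEulerCharTwo` ∘ `SignedEC.ResTwo.signedEulerChar_two_of_cassels_of_resTwo`
with Cassels from `SignedEC.CasselsPT.casselsSurjectivity_H1Sigma_of_poitouTate poitouTateSelmerRat` (unconditional since v15) and `hres` from
`SignedEC.ResTwo.resTwo_injective_of_shaTwo` ∘ `shaTwoPrimaryVanishing` (inside the `Finite Sel` binder).
[cite: BDKim2013, Cor. 3.15] [cite: Kobayashi2003, Thm. 1.2] -/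
theorem signedControl_body (W : WeierstrassCurve ℚ) [W.IsElliptic] [W.IsGloballyMinimal]
    (hss : Rank1Residual.GoodSS W 2) (ha : W.frobeniusTrace 2 = 0) :
    (∀ (κ : ZpExtension ℚ 2) (γ : Field.absoluteGaloisGroup ℚ), κ.IsCyclotomic → κ.IsTopGenerator γ →
        ∀ D : Kobayashi2003.SignedSelmerDualData W κ γ 1, Module.Finite (IwasawaAlgebra 2) D.X) ∧
      (∀ (κ : ZpExtension ℚ 2) (γ : Field.absoluteGaloisGroup ℚ), κ.IsCyclotomic → κ.IsTopGenerator γ →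
        ∀ (D : Kobayashi2003.SignedSelmerDualData W κ γ 1) [Module.Finite (IwasawaAlgebra 2) D.X],
          Module.IsTorsion (IwasawaAlgebra 2) D.X → ∀ g : IwasawaAlgebra 2, D.charIdeal = Ideal.span {g} →
          Finite (W.selmerGroupPInfty 2) →
          ∃ u : ℤ_[2]ˣ, ((PowerSeries.constantCoeff g : ℤ_[2]) : ℚ_[2]) =
            ((u : ℤ_[2]) : ℚ_[2]) * ((2 : ℕ) : ℚ_[2]) ^ (padicValNat 2 W.tamagawaProduct) *
              (Nat.card (W.selmerGroupPInfty 2) : ℚ_[2])) := by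
  have hC : Greenberg1999.casselsSurjectivity_H1Sigma ℚ :=
    Summit.BirchSwinnertonDyer.BirchSwinnertonDyer.Theorems.SignedEC.CasselsPT.casselsSurjectivity_H1Sigma_of_poitouTate
      poitouTateSelmerRat
  refine ⟨fun _ _ _ hγ D ↦ Kobayashi2003.SignedSelmerDualData.moduleFinite hγ D, ?_⟩
  exact Summit.BirchSwinnertonDyer.BirchSwinnertonDyer.Theorems.kimControl_at_of_signedEulerCharTwo
    fun κ _ hκ hγ hSel ↦
      Summit.BirchSwinnertonDyer.BirchSwinnertonDyer.Theorems.SignedEC.ResTwo.signedEulerChar_two_of_cassels_of_resTwo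
        W κ hss ha hκ hγ hC
        (fun c hc ↦
          Summit.BirchSwinnertonDyer.BirchSwinnertonDyer.Theorems.SignedEC.ResTwo.resTwo_injective_of_shaTwo W κ hss
            (shaTwoPrimaryVanishing W hss ha hSel) c hc)
        hSel

/-- COMPOSITION: K4 BY NAME (route `ThetaPartnerAtTwo` copy) from `signedControl_body` — the binders `¬ W.HasCM`,
`W.analyticRank = 0` are idle. -/
theorem SignedControlAtTwo_of :
    Summit.BirchSwinnertonDyer.BirchSwinnertonDyer.Theses.ThetaPartnerAtTwo.SignedControlAtTwo := by
  intro W _ _ _ _ hss ha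
  exact signedControl_body W hss ha

/-- COMPOSITION for the route `ResidualThetaTransportAtTwo` copy of the crux decl (identical body; the crux item is shared by both
routes). -/
theorem SignedControlAtTwo_rtt_of :
    Summit.BirchSwinnertonDyer.BirchSwinnertonDyer.Theses.ResidualThetaTransportAtTwo.SignedControlAtTwo := by
  intro W _ _ _ _ hss ha
  exact signedControl_body W hss ha

end Summit.BirchSwinnertonDyer.BirchSwinnertonDyer.Cruxes.SignedControlAtTwo.EulerChar

end
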